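import Literature.NumberTheory.EllipticCurves.BinaryQuarticFiniteFieldSolubilityProofs
import HarnessLib

/-!
# Bhargava–Shankar, Lemmas 5.10–5.11 over a finite field: the forms with invariants `(I, J)` fall
# into exactly `#E'(F)[2] = #(E'(F)/2E'(F))` classes, all of them soluble

`Proofs` companion (theorems only: no definitions, no named facts) of `BinaryQuarticForms.lean`,
`BinaryQuarticStabilizer.lean` and `BinaryQuarticFiniteFieldSolubilityProofs.lean`.

Source. M. Bhargava, A. Shankar, *Binary quartic forms having bounded invariants, and the
boundedness of the average rank of elliptic curves*, Ann. of Math. (2) 181 (2015) 191–242,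
Lemmas 5.10–5.11 of the held arXiv text `arXiv:1006.1002v2` (= Thm 3.2 of the published version):
over a field `K`, the `K`-soluble `PGL₂(K)`-classes of quartics with invariants `(I, J)` are in
bijection with `E(K)/2E(K)`, and the stabiliser of such a form in `PGL₂(K)` has `#E(K)[2]` elements.
Over a **finite** field `F` with `2 ≠ 0`, `3 ≠ 0` every form with `4I³ ≠ J²` is soluble
(`BinaryQuartic.isSoluble_of_disc_ne_zero_of_finite`), and the count of
`BinaryQuarticInvariantCountProofs` (`#{f : (I,J)} = q³ − q`) with the orbit sizes of
`BinaryQuarticFiniteFieldSolubilityProofs` (`#orbit · #Stab_{PGL₂} = q³ − q`) gives the class number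
directly:

* `BinaryQuartic.natCard_twistClasses_eq_pgl2StabilizerCard`: the classes of forms with invariants
  `(I(f₀), J(f₀))` under the twisted action of `GL₂(F)` number exactly `#Stab_{PGL₂(F)}(f₀)`
  (`= 1 + #{φ ∈ F : φ³ − 3Iφ + J = 0}`);
* `BinaryQuartic.natCard_twistClasses_eq_natCard_torsionBy_two`: **`= #E'_{I,J}(F)[2]`**
  (Lemma 5.11 form), and `BinaryQuartic.natCard_twistClasses_eq_natCard_quotient_two`:
  **`= #(E'_{I,J}(F)/2E'_{I,J}(F))`** (Lemma 5.10 form: all classes are soluble and they are as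
  many as the elements of `E/2E`), for `E'_{I,J} : Y² = X³ − 27IX − 27J`.

## References

* M. Bhargava, A. Shankar, Ann. of Math. (2) 181 (2015) 191–242 = arXiv:1006.1002, Lemmas 5.10–5.11
  (arXiv v2 numbering; Thm 3.2 of the published version). [cite: BhargavaShankarAnnals2015, Lemmas 5.10–5.11 (arXiv:1006.1002v2 numbering)]
-/

noncomputable section

open scoped Classical

namespace Literature.NumberTheory.EllipticCurves

namespace BinaryQuartic

variable {F : Type*} [Field F] [Fintype F]

omit [Fintype F] in
/-- Twisted `GL₂(F)`-equivalence is an equivalence relation on forms (used below on the forms with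
fixed invariants). [folklore] -/
theorem twistRel_equivalence :
    Equivalence (fun f g : BinaryQuartic F ↦ ∃ γ : Matrix (Fin 2) (Fin 2) F, γ.det ≠ 0 ∧ twist γ f = g) := by
  refine ⟨fun f ↦ ⟨1, by simp, twist_one f⟩, ?_, ?_⟩
  · rintro f g ⟨γ, hγ, rfl⟩
    refine ⟨γ⁻¹, ?_, twist_inv_twist hγ f⟩
    exact (Matrix.isUnit_nonsing_inv_det _ (isUnit_iff_ne_zero.mpr hγ)).ne_zero
  · rintro f g h ⟨γ, hγ, rfl⟩ ⟨δ, hδ, rfl⟩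
    exact ⟨δ * γ, by rw [Matrix.det_mul]; exact mul_ne_zero hδ hγ, twist_mul δ γ f⟩

/-- **The class number over a finite field: the forms with the invariants of `f₀` (`Δ(f₀) ≠ 0`)
form exactly `#Stab_{PGL₂(F)}(f₀)` classes under the twisted action of `GL₂(F)`** (every class
has `(q³ − q)/#Stab` elements and there are `q³ − q` forms). [cite: BhargavaShankarAnnals2015, Lemmas 5.10–5.11 (arXiv:1006.1002v2 numbering)] -/
theorem natCard_twistClasses_eq_pgl2StabilizerCard (h2 : (2 : F) ≠ 0) (h3 : (3 : F) ≠ 0)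
    {f₀ : BinaryQuartic F} (hΔ : f₀.disc ≠ 0) :
    Nat.card (Quotient (Setoid.comap (Subtype.val : {f : BinaryQuartic F // f.I = f₀.I ∧ f.J = f₀.J}
        → BinaryQuartic F) ⟨_, twistRel_equivalence (F := F)⟩)) = pgl2StabilizerCard f₀ := by
  set X := {f : BinaryQuartic F // f.I = f₀.I ∧ f.J = f₀.J} with hX
  set s : Setoid X := Setoid.comap (Subtype.val : X → BinaryQuartic F)
    ⟨_, twistRel_equivalence (F := F)⟩ with hs
  set G := Finset.univ.filter fun γ : Matrix (Fin 2) (Fin 2) F ↦ γ.det ≠ 0 with hG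
  -- every equivalence class inside `X` has `#orbit(f₀)`-many elements, `#orbit · #Stab = q³ − q`
  set m := (G.image fun γ ↦ twist γ f₀).card with hm
  have horb : ∀ f : X, (G.image fun γ ↦ twist γ f.1).card = m := by
    intro f
    have hIJ : 4 * f.1.I ^ 3 - f.1.J ^ 2 = 4 * f₀.I ^ 3 - f₀.J ^ 2 := by rw [f.2.1, f.2.2]
    have hfΔ : f.1.disc ≠ 0 := by
      intro h
      apply four_I_cube_sub_J_sq_ne_zero hΔ h3
      rw [← hIJ, ← twentySeven_mul_disc, h, mul_zero]
    have h1 := card_orbit_mul_pgl2StabilizerCard f.1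
    have h0 := card_orbit_mul_pgl2StabilizerCard f₀
    rw [pgl2StabilizerCard_eq_of_invariants_eq h2 h3 hΔ hfΔ f.2.1 f.2.2, ← h0] at h1
    have hspos : 0 < pgl2StabilizerCard f₀ := by
      rw [pgl2StabilizerCard_eq h2 h3 hΔ]; exact Nat.add_pos_left Nat.one_pos _
    have := Nat.eq_of_mul_eq_mul_right hspos h1
    rw [hm]
    exact this
  have hclass : ∀ f : X, Nat.card {g : X // s g f} = m := by
    intro f
    rw [← horb f]
    rw [← Nat.card_eq_finsetCard]
    refine Nat.card_congr
      { toFun := fun g ↦ ⟨g.1.1, by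
          obtain ⟨γ, hγ, hγg⟩ := (s.symm g.2 : s f g.1)
          exact Finset.mem_image.mpr ⟨γ, Finset.mem_filter.mpr ⟨Finset.mem_univ _, hγ⟩, hγg⟩⟩
        invFun := fun g ↦ ⟨⟨g.1, by
            obtain ⟨γ, hγ, hγg⟩ := Finset.mem_image.mp g.2
            have hγd : γ.det ≠ 0 := (Finset.mem_filter.mp hγ).2
            rw [← hγg, I_twist hγd, J_twist hγd]; exact f.2⟩, by
          obtain ⟨γ, hγ, hγg⟩ := Finset.mem_image.mp g.2
          have hγd : γ.det ≠ 0 := (Finset.mem_filter.mp hγ).2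
          exact s.symm (show s f _ from ⟨γ, hγd, hγg⟩)⟩
        left_inv := fun g ↦ rfl
        right_inv := fun g ↦ rfl }
  -- count `X` along the quotient map
  have hXcard : Nat.card X = Fintype.card F ^ 3 - Fintype.card F :=
    natCard_invariants_eq_of_disc_ne_zero h2 h3 hΔ
  have hsum : Nat.card X = Nat.card (Quotient s) * m := by
    rw [← Nat.card_congr (Equiv.sigmaFiberEquiv (Quotient.mk s)), Nat.card_sigma]
    have hfib : ∀ c : Quotient s, Nat.card {x : X // Quotient.mk s x = c} = m := by
      intro c
      induction c using Quotient.inductionOn with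
      | h f =>
        rw [← hclass f]
        refine Nat.card_congr (Equiv.subtypeEquivRight fun g ↦ ?_)
        exact Quotient.eq
    rw [Finset.sum_congr rfl fun c _ ↦ hfib c, Finset.sum_const, Finset.card_univ, smul_eq_mul,
      Nat.card_eq_fintype_card]
  have h0 := card_orbit_mul_pgl2StabilizerCard f₀
  rw [← hm, ← hXcard, hsum, mul_comm] at h0
  have hmpos : 0 < m := by
    rw [hm, Finset.card_pos]
    exact ⟨f₀, Finset.mem_image.mpr ⟨1, Finset.mem_filter.mpr ⟨Finset.mem_univ _, by simp⟩,
      twist_one f₀⟩⟩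
  exact (Nat.eq_of_mul_eq_mul_right hmpos h0).symm

/-- **Lemma 5.11 over a finite field: the class number equals `#E'_{I,J}(F)[2]`** for the curve
`E'_{I,J} : Y² = X³ − 27IX − 27J`, `(I, J) = (I(f₀), J(f₀))`. [cite: BhargavaShankarAnnals2015, Lemmas 5.10–5.11 (arXiv:1006.1002v2 numbering)] -/
theorem natCard_twistClasses_eq_natCard_torsionBy_two (h2 : (2 : F) ≠ 0) (h3 : (3 : F) ≠ 0)
    {f₀ : BinaryQuartic F} (hΔ : f₀.disc ≠ 0) :
    Nat.card (Quotient (Setoid.comap (Subtype.val : {f : BinaryQuartic F // f.I = f₀.I ∧ f.J = f₀.J}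
        → BinaryQuartic F) ⟨_, twistRel_equivalence (F := F)⟩)) =
      Nat.card (AddSubgroup.torsionBy
        (⟨0, 0, 0, -27 * f₀.I, -27 * f₀.J⟩ : WeierstrassCurve F).toAffine.Point (2 : ℤ)) := by
  rw [natCard_twistClasses_eq_pgl2StabilizerCard h2 h3 hΔ, natCard_torsionBy_two_cremona h2 h3 hΔ rfl rfl]

/-- **Lemma 5.10 over a finite field: the class number equals `#(E'_{I,J}(F)/2E'_{I,J}(F))`**, and
(by `isSoluble_of_disc_ne_zero_of_finite`) every class is soluble — the soluble classes are as
many as the elements of `E/2E`. [cite: BhargavaShankarAnnals2015, Lemmas 5.10–5.11 (arXiv:1006.1002v2 numbering)] -/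
theorem natCard_twistClasses_eq_natCard_quotient_two (h2 : (2 : F) ≠ 0) (h3 : (3 : F) ≠ 0)
    {f₀ : BinaryQuartic F} (hΔ : f₀.disc ≠ 0) :
    Nat.card (Quotient (Setoid.comap (Subtype.val : {f : BinaryQuartic F // f.I = f₀.I ∧ f.J = f₀.J}
        → BinaryQuartic F) ⟨_, twistRel_equivalence (F := F)⟩)) =
      Nat.card ((⟨0, 0, 0, -27 * f₀.I, -27 * f₀.J⟩ : WeierstrassCurve F).toAffine.Point ⧸
        (zsmulAddGroupHom 2 :
          (⟨0, 0, 0, -27 * f₀.I, -27 * f₀.J⟩ : WeierstrassCurve F).toAffine.Point →+ _).range) := by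
  haveI := finite_point (⟨0, 0, 0, -27 * f₀.I, -27 * f₀.J⟩ : WeierstrassCurve F)
  have hker : (zsmulAddGroupHom 2 :
      (⟨0, 0, 0, -27 * f₀.I, -27 * f₀.J⟩ : WeierstrassCurve F).toAffine.Point →+ _).ker =
      AddSubgroup.torsionBy
        (⟨0, 0, 0, -27 * f₀.I, -27 * f₀.J⟩ : WeierstrassCurve F).toAffine.Point (2 : ℤ) := by
    ext P
    rw [AddMonoidHom.mem_ker, zsmulAddGroupHom_apply, AddSubgroup.torsionBy,
      Submodule.mem_toAddSubgroup, Submodule.mem_torsionBy_iff]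
  rw [natCard_twistClasses_eq_natCard_torsionBy_two h2 h3 hΔ, natCard_quotient_range_eq_natCard_ker,
    hker]

end BinaryQuartic

end Literature.NumberTheory.EllipticCurves

end
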